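import Summits.QuantumFields.BalabanUV.Beta.EriceRemainderEnclosureHistoryAutonomyThreshold

/-!
# EriceRemainderEnclosureHistoryAutonomyComparisonIsotone — (E49h) ISOTONE MEMORY: A TWO-STEP CRITERION FOR COMPARISON.  For `B` ISOTONE in the history
# (so node U2's solution map `T = picard B p` is ANTITONE) with zeroth moment `M`, floor `b > 0` on ]0,γ] and the OPEN threshold `M·γ < 3√3·b` ((E38a): `T`
# is a strict sup-contraction), a box history `v` with `T v ≤ v` AND `T (T v) ≤ v` traps the box solution: `T v ≤ h ≤ v` at every scale — the order
# interval `[T v, v]` is `T`-invariant and the iterates from `v` converge to `h`.  COROLLARY: `B₀ ≤ B` on the box (`B₀` with a floor, arbitrary otherwise),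
# `h₀` any box solution of `B₀` from `p` — then `T h₀ ≤ h₀` is automatic and `T (T h₀) ≤ h₀` ⟹ `h ≤ h₀`: for isotone memory TWO PICARD STEPS of the larger
# functional from the smaller solution DECIDE the comparison that (E49b) shows can fail; dually from below

Cell `pub-balaban`, β-function sub-cell, BINDER row D4 «RemainderConst leaves for Bałaban's split» (`HOME/BINDER-OWNERS.md`; owner lineage `b2b-balaban-beta-an4`;
this file by co-owner #2 lineage `b2b-balaban-beta-d4-p2`, generation 46), β-FLOW TEAM duty (1), FREEZE (0) honoured (def-free; node U2's `MemFlow` ∕ `SeqBox` ∕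
`picard` ∕ `drive` ∕ `picard_seqBox` ∕ `picard_eq_of_memFlow` ∕ `base_pos` ∕ `one_div_sqrt_anti` ∕ `abs_sub_le_of_seqBox`, (E38a)'s `picard_contraction_zs` ∕
`three_sqrt_three_pos` BY NAME, nothing restated; Mathlib `Function.iterate`).  Companion of (E49a) `…HistoryAutonomyComparison` (ANTITONE memory: comparison by
Tarski, no smallness), (E49b) `…ComparisonWitness` (ISOTONE memory: comparison can FAIL), (E49c) `…ComparisonPerron`.

HONEST FRAMING (page 1, verbatim and binding).  *"Discharging BetaPertH makes Bałaban's UV stability UNCONDITIONAL — a real constructive-QFT result; it is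
NOT the continuum limit and NOT the Clay problem."*  THIS FILE DISCHARGES NOTHING OF THE KIND.  Elementary real analysis about an ABSTRACT functional with
displayed zeroth moment, floor and sign of the memory — hypotheses, not facts; nothing of Bałaban's (1.22) asserted (the sign of its memory is NOT PRINTED,
[I] p. 298; GAPS G-t4-U2-1∕-2).  Row D4 class UNCHANGED (critical-path width 0; instance 0∕1; D4 DISCHARGE NO DATE).  HONEST DEPENDENCY: continuum YM on
T⁴ ⇐ BetaPertH ∧ nine spine estimates (0/9 proved); BetaPertH ⇐ (D1) ∧ (D4) ∧ CAP+tail; G-an2-4 gates asym, D1 and NE2/3/4.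

THE POINT (census sense (α)).  (E49a)∕(E49c): antitone memory ⟹ comparison; (E49b): isotone memory ⟹ comparison may fail.  What DOES decide it for
isotone memory?  With `T` antitone, `T v ≤ v` and `T²v ≤ v` make `[T v, v]` invariant (`T v ≤ w ≤ v ⟹ T v ≤ T w ≤ T²v ≤ v`), so all iterates
`Tⁿ v` stay there; under the open threshold they converge to the unique box solution `h`, hence `T v ≤ h ≤ v` (§2).  For `v = h₀` a box solution of
a SMALLER functional `B₀ ≤ B`, `T h₀ = picard B p h₀ ≤ picard B₀ p h₀ = h₀` holds for free, so the single inequality `T(T h₀) ≤ h₀` — two explicit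
Picard steps — implies `h ≤ h₀` (§3); dually `T(T h₁) ≥ h₁` for a solution `h₁` of a LARGER `B₁ ≥ B` implies `h₁ ≤ h`.  Whether `T²h₀ ≤ h₀` holds is a
quantitative question about how the excess `B − B₀` is distributed along the trajectory ((E49b)'s switch is back-loaded and fails it); NOT decided here.

WHAT IS PROVED ([folklore]; 0 `def`, 0 sorry).  §1 **`picard_anti_of_isotone`**, `picard_anti_functional'`.  §2 `iterate_seqBox_of_interval`, **`iterate_mem_interval`**
(`[T v, v]` is invariant), `abs_iterate_sub_solution_le` (`|Tⁿv − h| ≤ γ·qⁿ`, `q = M·γ∕(3√3·b)`), **`solution_mem_interval_of_two_step`** (`T v ≤ h ≤ v`).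
§3 **`le_of_two_step`** (`B₀ ≤ B`, `T(T h₀) ≤ h₀ ⟹ h ≤ h₀`), **`ge_of_two_step`** (`B ≤ B₁`, `h₁ ≤ T(T h₁) ⟹ h₁ ≤ h`).
-/

noncomputable section
open Filter Topology Finset Set

namespace Summit.QuantumFields.BalabanUV.Beta.EriceRemainderEnclosureHistoryAutonomyComparisonIsotone

open Literature.MathematicalPhysics.QuantumFieldTheory.Balaban1983to89
open Literature.MathematicalPhysics.QuantumFieldTheory.Balaban1983to89.T4BetaStationary
open Literature.MathematicalPhysics.QuantumFieldTheory.Balaban1983to89.T4BetaFlowWellPosed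
open Summit.QuantumFields.BalabanUV.Beta.EriceRemainderEnclosureHistoryAutonomyThreshold (picard_contraction_zs three_sqrt_three_pos)

variable {B B₀ B₁ : (ℕ → ℝ) → ℝ} {M γ b p : ℝ} {h v w : ℕ → ℝ}

/-! ## §1 Isotone memory makes the solution map antitone -/

/-- **ISOTONE MEMORY MAKES THE SOLUTION MAP ANTITONE**: `B` non-decreasing in the history ⟹ box histories `v ≤ w` have `picard B p w ≤ picard B p v`.
[folklore] -/
theorem picard_anti_of_isotone (hmono : ∀ u u' : ℕ → ℝ, SeqBox γ u → SeqBox γ u' → (∀ j, u j ≤ u' j) → B u ≤ B u')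
    (hp : 0 < p) (hb : 0 < b) (hlo : ∀ u, SeqBox γ u → b ≤ B u) (hv : SeqBox γ v) (hw : SeqBox γ w) (hvw : ∀ j, v j ≤ w j)
    (m : ℕ) : picard B p w m ≤ picard B p v m := by
  refine one_div_sqrt_anti (base_pos hp hb hlo hv m) (add_le_add le_rfl ?_)
  unfold drive
  exact sum_le_sum fun l _ => hmono _ _ (seqBox_shift hv (l + 1)) (seqBox_shift hw (l + 1)) fun j => hvw (l + 1 + j)

/-- `B₀ ≤ B` on the box ⟹ `picard B p v ≤ picard B₀ p v` (`B₀` with a floor `b₀ > 0`). [folklore] -/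
theorem picard_anti_functional' {b₀ : ℝ} (hB₀B : ∀ u, SeqBox γ u → B₀ u ≤ B u) (hp : 0 < p) (hb₀ : 0 < b₀)
    (hlo₀ : ∀ u, SeqBox γ u → b₀ ≤ B₀ u) (hv : SeqBox γ v) (m : ℕ) : picard B p v m ≤ picard B₀ p v m := by
  refine one_div_sqrt_anti (base_pos hp hb₀ hlo₀ hv m) (add_le_add le_rfl ?_)
  unfold drive
  exact sum_le_sum fun l _ => hB₀B _ (seqBox_shift hv (l + 1))

/-! ## §2 The two-step trap: `T v ≤ v` and `T (T v) ≤ v` confine the solution to `[T v, v]` -/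

/-- The iterates of the solution map from a box history are box histories (`p ∈ ]0,γ]`). [folklore] -/
theorem iterate_seqBox_of_interval (hp : 0 < p) (hpγ : p ≤ γ) (hb : 0 < b) (hlo : ∀ u, SeqBox γ u → b ≤ B u) (hv : SeqBox γ v) :
    ∀ n : ℕ, SeqBox γ ((picard B p)^[n] v)
  | 0 => by simpa using hv
  | n + 1 => by
    rw [Function.iterate_succ_apply']
    exact picard_seqBox hp hpγ hb hlo (iterate_seqBox_of_interval hp hpγ hb hlo hv n)

/-- **THE ORDER INTERVAL `[T v, v]` IS INVARIANT** (`B` isotone, `T = picard B p`, `T v ≤ v`, `T (T v) ≤ v`): every iterate satisfies `T v ≤ Tⁿ v ≤ v`.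
[folklore] -/
theorem iterate_mem_interval (hmono : ∀ u u' : ℕ → ℝ, SeqBox γ u → SeqBox γ u' → (∀ j, u j ≤ u' j) → B u ≤ B u')
    (hp : 0 < p) (hpγ : p ≤ γ) (hb : 0 < b) (hlo : ∀ u, SeqBox γ u → b ≤ B u) (hv : SeqBox γ v)
    (h1 : ∀ m, picard B p v m ≤ v m) (h2 : ∀ m, picard B p (picard B p v) m ≤ v m) :
    ∀ n m, picard B p v m ≤ (picard B p)^[n] v m ∧ (picard B p)^[n] v m ≤ v m
  | 0, m => by simpa using h1 m
  | n + 1, m => by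
    have hn := iterate_mem_interval hmono hp hpγ hb hlo hv h1 h2 n
    have hbox := iterate_seqBox_of_interval hp hpγ hb hlo hv n
    have hTv : SeqBox γ (picard B p v) := picard_seqBox hp hpγ hb hlo hv
    rw [Function.iterate_succ_apply']
    exact ⟨picard_anti_of_isotone hmono hp hb hlo hbox hv (fun j => (hn j).2) m,
      (picard_anti_of_isotone hmono hp hb hlo hTv hbox (fun j => (hn j).1) m).trans (h2 m)⟩

/-- GEOMETRIC CONVERGENCE OF THE ITERATES TO THE SOLUTION below the open threshold: `|Tⁿ v − h| ≤ γ·qⁿ`, `q = M·γ∕(3√3·b)` ((E38a)'s contraction,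
iterated from the box bound `|v − h| ≤ γ`). [folklore] -/
theorem abs_iterate_sub_solution_le
    (hB : ∀ u u' : ℕ → ℝ, SeqBox γ u → SeqBox γ u' → ∀ D : ℝ, (∀ j, |u j - u' j| ≤ D) → |B u - B u'| ≤ M * D)
    (hM : 0 ≤ M) (hp : 0 < p) (hpγ : p ≤ γ) (hb : 0 < b) (hlo : ∀ u, SeqBox γ u → b ≤ B u) (hv : SeqBox γ v) (hh : SeqBox γ h)
    (hf : MemFlow B p h) : ∀ n m, |(picard B p)^[n] v m - h m| ≤ γ * (M * γ / (3 * Real.sqrt 3 * b)) ^ n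
  | 0, m => by simpa using abs_sub_le_of_seqBox hv hh m
  | n + 1, m => by
    have ih := abs_iterate_sub_solution_le hB hM hp hpγ hb hlo hv hh hf n
    have hfix : picard B p h = h := picard_eq_of_memFlow hf fun j => (hh j).1
    rw [Function.iterate_succ_apply']
    calc |picard B p ((picard B p)^[n] v) m - h m| = |picard B p ((picard B p)^[n] v) m - picard B p h m| := by rw [hfix]
      _ ≤ M * γ / (3 * Real.sqrt 3 * b) * (γ * (M * γ / (3 * Real.sqrt 3 * b)) ^ n) :=
          picard_contraction_zs hB hM hp hpγ hb hlo (iterate_seqBox_of_interval hp hpγ hb hlo hv n) hh ih m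
      _ = γ * (M * γ / (3 * Real.sqrt 3 * b)) ^ (n + 1) := by ring

/-- **THE TWO-STEP TRAP.**  `B` ISOTONE with zeroth moment `M ≥ 0`, floor `b > 0` on ]0,γ], OPEN threshold `M·γ < 3√3·b`; `h` a box solution from
`p ∈ ]0,γ]`; `v` a box history with `T v ≤ v` and `T (T v) ≤ v` (`T = picard B p`).  Then `T v ≤ h ≤ v` at every scale. [folklore] -/
theorem solution_mem_interval_of_two_step
    (hmono : ∀ u u' : ℕ → ℝ, SeqBox γ u → SeqBox γ u' → (∀ j, u j ≤ u' j) → B u ≤ B u')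
    (hB : ∀ u u' : ℕ → ℝ, SeqBox γ u → SeqBox γ u' → ∀ D : ℝ, (∀ j, |u j - u' j| ≤ D) → |B u - B u'| ≤ M * D)
    (hM : 0 ≤ M) (hp : 0 < p) (hpγ : p ≤ γ) (hb : 0 < b) (hlo : ∀ u, SeqBox γ u → b ≤ B u) (hsmall : M * γ < 3 * Real.sqrt 3 * b)
    (hh : SeqBox γ h) (hf : MemFlow B p h) (hv : SeqBox γ v)
    (h1 : ∀ m, picard B p v m ≤ v m) (h2 : ∀ m, picard B p (picard B p v) m ≤ v m) (m : ℕ) :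
    picard B p v m ≤ h m ∧ h m ≤ v m := by
  have hγ : 0 < γ := hp.trans_le hpγ
  have h33 : 0 < 3 * Real.sqrt 3 * b := mul_pos three_sqrt_three_pos hb
  have hq0 : 0 ≤ M * γ / (3 * Real.sqrt 3 * b) := div_nonneg (mul_nonneg hM hγ.le) h33.le
  have hq1 : M * γ / (3 * Real.sqrt 3 * b) < 1 := (div_lt_one h33).mpr hsmall
  -- the iterates converge to `h m`
  have hlim : Tendsto (fun n => (picard B p)^[n] v m) atTop (𝓝 (h m)) := by
    have hr : Tendsto (fun n : ℕ => γ * (M * γ / (3 * Real.sqrt 3 * b)) ^ n) atTop (𝓝 (γ * 0)) :=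
      (tendsto_pow_atTop_nhds_zero_of_lt_one hq0 hq1).const_mul γ
    rw [mul_zero] at hr
    have h0 : Tendsto (fun n => (picard B p)^[n] v m - h m) atTop (𝓝 0) :=
      squeeze_zero_norm (fun n => by rw [Real.norm_eq_abs]; exact abs_iterate_sub_solution_le hB hM hp hpγ hb hlo hv hh hf n m) hr
    have := h0.add_const (h m)
    simpa using this
  have hmem := fun n => iterate_mem_interval hmono hp hpγ hb hlo hv h1 h2 n m
  exact ⟨ge_of_tendsto' hlim fun n => (hmem n).1, le_of_tendsto' hlim fun n => (hmem n).2⟩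

/-! ## §3 Two Picard steps decide comparison for isotone memory -/

/-- **TWO PICARD STEPS OF THE LARGER FUNCTIONAL FROM THE SMALLER SOLUTION DECIDE.**  `B₀ ≤ B` on the box (`B₀` with a floor `b₀ > 0`, arbitrary
otherwise), `h₀` any box solution of `B₀` from `p`; `B` ISOTONE with zeroth moment `M`, floor `b`, `M·γ < 3√3·b`, `h` a box solution of `B` from `p`.
If `picard B p (picard B p h₀) ≤ h₀` then `h ≤ h₀` at EVERY scale (and `picard B p h₀ ≤ h`). [folklore] -/
theorem le_of_two_step {b₀ : ℝ} {h₀ : ℕ → ℝ}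
    (hmono : ∀ u u' : ℕ → ℝ, SeqBox γ u → SeqBox γ u' → (∀ j, u j ≤ u' j) → B u ≤ B u')
    (hB : ∀ u u' : ℕ → ℝ, SeqBox γ u → SeqBox γ u' → ∀ D : ℝ, (∀ j, |u j - u' j| ≤ D) → |B u - B u'| ≤ M * D)
    (hM : 0 ≤ M) (hp : 0 < p) (hpγ : p ≤ γ) (hb : 0 < b) (hlo : ∀ u, SeqBox γ u → b ≤ B u) (hsmall : M * γ < 3 * Real.sqrt 3 * b)
    (hB₀B : ∀ u, SeqBox γ u → B₀ u ≤ B u) (hb₀ : 0 < b₀) (hlo₀ : ∀ u, SeqBox γ u → b₀ ≤ B₀ u)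
    (hh : SeqBox γ h) (hf : MemFlow B p h) (hh₀ : SeqBox γ h₀) (hf₀ : MemFlow B₀ p h₀)
    (h2 : ∀ m, picard B p (picard B p h₀) m ≤ h₀ m) (m : ℕ) : picard B p h₀ m ≤ h m ∧ h m ≤ h₀ m := by
  have h1 : ∀ m, picard B p h₀ m ≤ h₀ m := fun m =>
    (picard_anti_functional' hB₀B hp hb₀ hlo₀ hh₀ m).trans_eq (congrFun (picard_eq_of_memFlow hf₀ fun j => (hh₀ j).1) m)
  exact solution_mem_interval_of_two_step hmono hB hM hp hpγ hb hlo hsmall hh hf hh₀ h1 h2 m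

/-- **… AND FROM BELOW**: `B ≤ B₁` on the box, `h₁` any box solution of `B₁` from `p`; `B` isotone, `M·γ < 3√3·b`, `h` its box solution from `p`.  If
`h₁ ≤ picard B p (picard B p h₁)` then `h₁ ≤ h` at every scale (and `h ≤ picard B p h₁`): the interval `[h₁, T h₁]` is invariant. [folklore] -/
theorem ge_of_two_step {h₁ : ℕ → ℝ}
    (hmono : ∀ u u' : ℕ → ℝ, SeqBox γ u → SeqBox γ u' → (∀ j, u j ≤ u' j) → B u ≤ B u')
    (hB : ∀ u u' : ℕ → ℝ, SeqBox γ u → SeqBox γ u' → ∀ D : ℝ, (∀ j, |u j - u' j| ≤ D) → |B u - B u'| ≤ M * D)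
    (hM : 0 ≤ M) (hp : 0 < p) (hpγ : p ≤ γ) (hb : 0 < b) (hlo : ∀ u, SeqBox γ u → b ≤ B u) (hsmall : M * γ < 3 * Real.sqrt 3 * b)
    (hBB₁ : ∀ u, SeqBox γ u → B u ≤ B₁ u)
    (hh : SeqBox γ h) (hf : MemFlow B p h) (hh₁ : SeqBox γ h₁) (hf₁ : MemFlow B₁ p h₁)
    (h2 : ∀ m, h₁ m ≤ picard B p (picard B p h₁) m) (m : ℕ) : h₁ m ≤ h m ∧ h m ≤ picard B p h₁ m := by
  -- apply the trap to `v = T h₁`: `T v = T² h₁ ≤ T h₁` and `T (T v) = T³ h₁ ≤ T h₁`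
  have hTh₁ : SeqBox γ (picard B p h₁) := picard_seqBox hp hpγ hb hlo hh₁
  have h1' : ∀ m, h₁ m ≤ picard B p h₁ m := fun m =>
    (congrFun (picard_eq_of_memFlow hf₁ fun j => (hh₁ j).1) m).symm.trans_le
      (one_div_sqrt_anti (base_pos hp hb hlo hh₁ m) (add_le_add le_rfl (by
        unfold drive; exact sum_le_sum fun l _ => hBB₁ _ (seqBox_shift hh₁ (l + 1)))))
  have hT2 : SeqBox γ (picard B p (picard B p h₁)) := picard_seqBox hp hpγ hb hlo hTh₁
  -- `T v ≤ v` for `v = T h₁`: from `h₁ ≤ T h₁` and antitonicity, `T (T h₁) ≤ T h₁`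
  have hv1 : ∀ m, picard B p (picard B p h₁) m ≤ picard B p h₁ m := fun m =>
    picard_anti_of_isotone hmono hp hb hlo hh₁ hTh₁ h1' m
  -- `T (T v) ≤ v`: `T³ h₁ ≤ T h₁` from `h₁ ≤ T² h₁` and antitone
  have hv2 : ∀ m, picard B p (picard B p (picard B p h₁)) m ≤ picard B p h₁ m := fun m =>
    picard_anti_of_isotone hmono hp hb hlo hh₁ hT2 h2 m
  have htrap := solution_mem_interval_of_two_step hmono hB hM hp hpγ hb hlo hsmall hh hf hTh₁ hv1 hv2 m
  exact ⟨(h2 m).trans htrap.1, htrap.2⟩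

end Summit.QuantumFields.BalabanUV.Beta.EriceRemainderEnclosureHistoryAutonomyComparisonIsotone

end
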